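import Summits.AtomisticToContinuum.BoseEinsteinCondensation.Theorems.BECThomsonPrincipleFibreConductanceConditionalDefs
import Mathlib.MeasureTheory.Integral.MeanInequalities
import HarnessLib

/-!
# Route `BECThomsonPrinciple`, crux `FibreConductance` (stmt-AtomisticToContinuum-9480),
# line `conditional-law-poincare` — towards `stub_coarseBeatDual`: the BATH-HÖLDER SPLIT of the
# cell-scale Sobolev moment of the coarse beat charge

The lead reduced the line's infrared stub `stub_coarseBeatDual` (`CoarseBeatDualBound`) to the
CELL-SCALE SOBOLEV MOMENT of the coarse beat charge `ρ₁ := coarseOf L (waveBlocks n) Φ (cruxCharge n Φ)`: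
`L⁻³ ∫_{cellN} U·P·W dX` with the flat mass `U(X̂) = ∫_cell ‖ρ₁(X[0↦y])‖² dy`, the cell hole factor
`P(X̂) = (∫_cell (ψ(X[0↦y])²)^{-3/2} dy)^{2/3}` and the bath weight `W = fibreW`. This file separates
LANDSCAPE from INFRARED by Hölder in the bath with exponents `3/2` (on `L³U`) and `3` (on `P`):

`∫ (L³U)·P·W = ∫ (L³U·W^{2/3})(P·W^{1/3}) ≤ (∫ (L³U)^{3/2} W)^{2/3} · (∫ P³ W)^{1/3}`.

* The first factor is the hypothesis `hfm` — a `(3/2)`-bath-moment of the flat coarse mass,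
  `∫_{cellN} (L³U)^{3/2} W ≤ K L³/‖n‖³` (the infrared input, to be supplied by the line).
* The second factor is gen 1's `ConditionalDensityMoments` at `p = 3`: by Cauchy–Schwarz on the cell
  `P³ = (∫_cell ψ⁻³)² ≤ L³ ∫_cell ψ⁻⁶`, and `ψ⁻⁶ = L⁹ g⁻³ ≤ L⁹ (g³ + g⁻³)` with `g = L³ψ²`, so by the
  fibre Fubini identity `lintegral_cellN_lintegral_update` (`W` is fibre-constant)
  `∫_{cellN} P³ W ≤ L¹² · L³ · ∫_{cellN} W (g³ + g⁻³) ≤ C₃ L¹⁸`.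
* Assembly: level `≤ L⁻³ · L⁻³ · (K L³/‖n‖³)^{2/3} (C₃ L¹⁸)^{1/3} = K^{2/3} C₃^{1/3} L²/‖n‖²`; we
  record the cruder constant `B = (K + 1)²(C₃ + 1)` (`K ≤ (K+1)³`, `C₃ ≤ (C₃+1)³`), with
  `ρ₀ = min`, `N₀ = max` of the two inputs' thresholds.

Measurability of `U` (needed by Hölder) comes from the measurability of the coarse part — the
continuous branches `ψ²·c_Q/μ_Q` selected by the measurable cube index of `x₀`
(`measurable_select`, `measurable_cubeIdx`). Helper prefix `cfm_`. All [folklore] (Hölder /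
Cauchy–Schwarz in `ℝ≥0∞`, `Mathlib.MeasureTheory.Integral.MeanInequalities`, and bookkeeping over the
landed vocabulary `…ConditionalDefs`, `BECThomsonPrincipleFibreFubini`, `…StubTwoScaleSplitHelpers`).
-/

noncomputable section

namespace Summit.AtomisticToContinuum.BoseEinsteinCondensation.Cruxes.FibreConductance.ConditionalLawPoincare

open MeasureTheory Set
open scoped ENNReal
open Literature.MathematicalPhysics.QuantumManyBody.BoseGas
open Summit.AtomisticToContinuum.BoseEinsteinCondensation.Cruxes.FibreConductance.ParsevalShellBootstrap
open Summit.AtomisticToContinuum.BoseEinsteinCondensation.Cruxes.FibreConductance.HealingSplitKineticDefect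
open Summit.AtomisticToContinuum.BoseEinsteinCondensation.Cruxes.FibreConductance.TaggedPathHarnack
  (ConditionalDensityMoments)

variable {m : ℕ} {L : ℝ}

/-! ### Generic tools: Hölder `(3/2, 3)` and Cauchy–Schwarz in `ℝ≥0∞` (prefix `cfm_`) -/

section Tools

variable {α : Type*} [MeasurableSpace α]

/-- Hölder with exponents `3/2` and `3` against a weight `w`:
`∫ f g w ≤ (∫ f^{3/2} w)^{2/3} (∫ g³ w)^{1/3}` (split `w = w^{2/3} · w^{1/3}`). [folklore] -/
theorem cfm_lintegral_mul_mul_le (μ : Measure α) {f g w : α → ℝ≥0∞} (hf : AEMeasurable f μ)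
    (hg : AEMeasurable g μ) (hw : AEMeasurable w μ) :
    ∫⁻ a, f a * g a * w a ∂μ ≤
      (∫⁻ a, f a ^ (3 / 2 : ℝ) * w a ∂μ) ^ (2 / 3 : ℝ) * (∫⁻ a, g a ^ 3 * w a ∂μ) ^ (1 / 3 : ℝ) := by
  have hpq : (3 / 2 : ℝ).HolderConjugate 3 := Real.holderConjugate_iff.2 ⟨by norm_num, by norm_num⟩
  have h := ENNReal.lintegral_mul_le_Lp_mul_Lq μ hpq (hf.mul (hw.pow_const (2 / 3 : ℝ)))
    (hg.mul (hw.pow_const (1 / 3 : ℝ)))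
  have e1 : ∀ a, f a * g a * w a = (f a * w a ^ (2 / 3 : ℝ)) * (g a * w a ^ (1 / 3 : ℝ)) := by
    intro a
    rw [mul_mul_mul_comm, ← ENNReal.rpow_add_of_nonneg _ _ (by norm_num) (by norm_num),
      show (2 / 3 : ℝ) + 1 / 3 = 1 by norm_num, ENNReal.rpow_one]
  have e2 : ∀ a, (f a * w a ^ (2 / 3 : ℝ)) ^ (3 / 2 : ℝ) = f a ^ (3 / 2 : ℝ) * w a := by
    intro a
    rw [ENNReal.mul_rpow_of_nonneg _ _ (by norm_num), ← ENNReal.rpow_mul,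
      show (2 / 3 : ℝ) * (3 / 2) = 1 by norm_num, ENNReal.rpow_one]
  have e3 : ∀ a, (g a * w a ^ (1 / 3 : ℝ)) ^ (3 : ℝ) = g a ^ 3 * w a := by
    intro a
    rw [ENNReal.mul_rpow_of_nonneg _ _ (by norm_num), ← ENNReal.rpow_mul,
      show (1 / 3 : ℝ) * 3 = 1 by norm_num, ENNReal.rpow_one, ENNReal.rpow_ofNat]
  have e4 : (1 : ℝ) / (3 / 2) = 2 / 3 := by norm_num
  simp only [Pi.mul_apply, e2, e3, e4] at h
  calc ∫⁻ a, f a * g a * w a ∂μ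
      = ∫⁻ a, (f a * w a ^ (2 / 3 : ℝ)) * (g a * w a ^ (1 / 3 : ℝ)) ∂μ :=
        lintegral_congr fun a => e1 a
    _ ≤ _ := h

/-- Cauchy–Schwarz against the constant `1`: `(∫ f)² ≤ μ(univ) · ∫ f²`. [folklore] -/
theorem cfm_lintegral_sq_le (μ : Measure α) {f : α → ℝ≥0∞} (hf : AEMeasurable f μ) :
    (∫⁻ a, f a ∂μ) ^ 2 ≤ μ univ * ∫⁻ a, f a ^ 2 ∂μ := by
  have h := ENNReal.lintegral_mul_le_Lp_mul_Lq μ Real.HolderConjugate.two_two hf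
    (aemeasurable_const (b := (1 : ℝ≥0∞)))
  simp only [Pi.mul_apply, mul_one, one_pow, lintegral_const, one_mul, ENNReal.rpow_two] at h
  have e : ∀ y : ℝ≥0∞, (y ^ (1 / 2 : ℝ)) ^ 2 = y := fun y => by
    rw [← ENNReal.rpow_natCast, ← ENNReal.rpow_mul]; norm_num
  calc (∫⁻ a, f a ∂μ) ^ 2
      ≤ ((∫⁻ a, f a ^ 2 ∂μ) ^ (1 / 2 : ℝ) * (μ univ) ^ (1 / 2 : ℝ)) ^ 2 := by gcongr
    _ = μ univ * ∫⁻ a, f a ^ 2 ∂μ := by rw [mul_pow, e, e, mul_comm]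

/-- The `ℝ≥0∞` skeleton of the split: if `∫ (cU)^{3/2} W ≤ a³` and `∫ P³ W ≤ b³` then
`c⁻¹ ∫ U P W ≤ c⁻¹ · c⁻¹ · a² b` (`0 < c < ∞`; Hölder `(3/2, 3)` applied to `cU` and `P`). [folklore] -/
theorem cfm_assembly (μ : Measure α) {U P W : α → ℝ≥0∞} (hU : AEMeasurable U μ)
    (hP : AEMeasurable P μ) (hW : AEMeasurable W μ) {c a b : ℝ≥0∞} (hc0 : c ≠ 0) (hct : c ≠ ⊤)
    (hUb : ∫⁻ x, (c * U x) ^ (3 / 2 : ℝ) * W x ∂μ ≤ a ^ 3)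
    (hPb : ∫⁻ x, P x ^ 3 * W x ∂μ ≤ b ^ 3) :
    c⁻¹ * ∫⁻ x, U x * P x * W x ∂μ ≤ c⁻¹ * (c⁻¹ * (a ^ 2 * b)) := by
  have hcU : AEMeasurable (fun x => c * U x) μ := hU.const_mul c
  have hH := cfm_lintegral_mul_mul_le μ hcU hP hW
  have e1 : ∫⁻ x, U x * P x * W x ∂μ = c⁻¹ * ∫⁻ x, c * U x * P x * W x ∂μ := by
    rw [← lintegral_const_mul' _ _ (ENNReal.inv_ne_top.2 hc0)]
    refine lintegral_congr fun x => ?_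
    rw [← mul_assoc, ← mul_assoc, ← mul_assoc, ENNReal.inv_mul_cancel hc0 hct, one_mul]
  have e2 : (a ^ 3) ^ (2 / 3 : ℝ) = a ^ 2 := by
    rw [← ENNReal.rpow_natCast, ← ENNReal.rpow_mul, ← ENNReal.rpow_natCast]; norm_num
  have e3 : (b ^ 3) ^ (1 / 3 : ℝ) = b := by
    rw [← ENNReal.rpow_natCast, ← ENNReal.rpow_mul]; norm_num
  rw [e1]
  gcongr c⁻¹ * (c⁻¹ * ?_)
  calc ∫⁻ x, c * U x * P x * W x ∂μ ≤ _ := hH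
    _ ≤ (a ^ 3) ^ (2 / 3 : ℝ) * (b ^ 3) ^ (1 / 3 : ℝ) := by gcongr
    _ = a ^ 2 * b := by rw [e2, e3]

end Tools

/-! ### The coarse part is measurable; the hole factor against `ConditionalDensityMoments` -/

/-- The coarse part `ρ_c = ψ²·c_{Q(x₀)}/μ_{Q(x₀)}` of a continuous charge is measurable: the continuous
branches `ψ²·c_Q/μ_Q` (parametric integrals over the bounded cubes) selected by the measurable cube
index of `x₀`. [folklore] -/
theorem cfm_measurable_coarseOf (hL : 0 < L) (ν : ℕ) (Φ : PeriodicTrialState (m + 1) L)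
    (hΦ : ∀ X, Φ.ψ X ≠ 0) {ρ : Config (m + 1) → ℂ} (hρ : Continuous ρ) :
    Measurable (coarseOf L ν Φ ρ) := by
  have hψ := continuous_fibrePsi hL Φ hΦ
  have hbd : ∀ Q : Fin 3 → Fin (ν + 1), Bornology.IsBounded (cubeSet L ν Q) := fun Q =>
    (isBounded_cell L).subset (cubeSet_subset_cell hL Q)
  have hc : ∀ Q, Continuous (cubeChargeOf L ν ρ Q) := fun Q => by
    unfold cubeChargeOf
    exact continuous_parametric_setIntegral_of_isBounded (μ := volume) (hbd Q)
      (measurableSet_cubeSet L ν Q) (hρ.comp continuous_update_zero)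
  have hμ : ∀ Q, Continuous (cubeMass L ν Φ Q) := fun Q => by
    unfold cubeMass
    exact continuous_parametric_setIntegral_of_isBounded (μ := volume) (hbd Q)
      (measurableSet_cubeSet L ν Q) ((hψ.comp continuous_update_zero).pow 2)
  exact measurable_select (F := fun Q X => ((fibrePsi Φ X ^ 2 : ℝ) : ℂ) *
      (cubeChargeOf L ν ρ Q X / (cubeMass L ν Φ Q X : ℂ)))
    ((measurable_cubeIdx L ν).comp (measurable_pi_apply 0)) fun Q =>
    (Complex.continuous_ofReal.comp (hψ.pow 2)).measurable.mul
      ((hc Q).measurable.div (Complex.measurable_ofReal.comp (hμ Q).measurable))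

/-- `((s)^{-3/2})² = L⁹ · ((L³s)⁻¹)³` for `s > 0`, `L > 0` (`ψ⁻⁶ = L⁹ g⁻³`, `g = L³ψ²`). [folklore] -/
theorem cfm_rpow_sq_eq (hL : 0 < L) {s : ℝ} (hs : 0 < s) :
    (s ^ (-(3 / 2 : ℝ))) ^ 2 = L ^ 9 * ((L ^ 3 * s)⁻¹) ^ 3 := by
  have h1 : (s ^ (-(3 / 2 : ℝ))) ^ 2 = (s ^ 3)⁻¹ := by
    rw [Real.rpow_neg hs.le, inv_pow, ← Real.rpow_natCast, ← Real.rpow_mul hs.le]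
    norm_num
  rw [h1]
  field_simp

/-- **The cubed hole factor against the weight is a conditional density moment.** For a zero-free
state with `∫_{cellN} W (g³ + g⁻³) ≤ C L³` (`g = L³ψ²`; gen 1's `ConditionalDensityMoments` at
`p = 3`): `∫_{cellN} P³ W ≤ ((C + 1) L⁶)³`, where `P = (∫_cell (ψ²)^{-3/2} dy)^{2/3}` is the cell hole
factor — Cauchy–Schwarz on the cell (`P³ = (∫_cell ψ⁻³)² ≤ L³ ∫_cell ψ⁻⁶`), `ψ⁻⁶ = L⁹g⁻³ ≤ L⁹(g³ + g⁻³)`,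
fibre constancy of `W` and the fibre Fubini identity `lintegral_cellN_lintegral_update`. [folklore] -/
theorem cfm_hole_moment_le (hL : 0 < L) (Φ : PeriodicTrialState (m + 1) L) (hΦ : ∀ X, Φ.ψ X ≠ 0)
    {C : ℝ} (hC : 0 ≤ C)
    (h3 : ∫⁻ X in cellN (m + 1) L, ENNReal.ofReal (fibreW Φ X *
        ((L ^ 3 * fibrePsi Φ X ^ 2) ^ 3 + ((L ^ 3 * fibrePsi Φ X ^ 2)⁻¹) ^ 3)) ≤
      ENNReal.ofReal (C * L ^ 3)) :
    ∫⁻ X in cellN (m + 1) L, ((∫⁻ y in cell L,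
        ENNReal.ofReal ((fibrePsi Φ (Function.update X 0 y) ^ 2) ^ (-(3 / 2 : ℝ)))) ^ (2 / 3 : ℝ)) ^ 3 *
          ENNReal.ofReal (fibreW Φ X) ≤
      ENNReal.ofReal ((C + 1) * L ^ 6) ^ 3 := by
  -- the moment integrand `G = W (g³ + g⁻³)`, `g = L³ψ²`
  set G : Config (m + 1) → ℝ≥0∞ := fun Z => ENNReal.ofReal (fibreW Φ Z *
      ((L ^ 3 * fibrePsi Φ Z ^ 2) ^ 3 + ((L ^ 3 * fibrePsi Φ Z ^ 2)⁻¹) ^ 3)) with hG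
  have hg : Measurable fun Z => L ^ 3 * fibrePsi Φ Z ^ 2 :=
    measurable_const.mul ((measurable_fibrePsi hL Φ hΦ).pow_const 2)
  have hGm : Measurable G :=
    ((measurable_fibreW Φ).mul ((hg.pow_const 3).add (hg.inv.pow_const 3))).ennreal_ofReal
  have hψc := continuous_fibrePsi hL Φ hΦ
  have hL3 : (0 : ℝ) ≤ L ^ 3 := by positivity
  have hL9 : (0 : ℝ) ≤ L ^ 9 := by positivity
  -- the fibrewise bound `P(X̂)³ W(X̂) ≤ L³ · L⁹ · ∫_cell G(X[0↦y]) dy`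
  have hfib : ∀ X : Config (m + 1), ((∫⁻ y in cell L,
      ENNReal.ofReal ((fibrePsi Φ (Function.update X 0 y) ^ 2) ^ (-(3 / 2 : ℝ)))) ^ (2 / 3 : ℝ)) ^ 3 *
        ENNReal.ofReal (fibreW Φ X) ≤
      ENNReal.ofReal (L ^ 3) * (ENNReal.ofReal (L ^ 9) * ∫⁻ y in cell L, G (Function.update X 0 y)) := by
    intro X
    have hmeas : AEMeasurable (fun y => ENNReal.ofReal
        ((fibrePsi Φ (Function.update X 0 y) ^ 2) ^ (-(3 / 2 : ℝ)))) (volume.restrict (cell L)) :=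
      ((((hψc.comp (continuous_const.update 0 continuous_id)).measurable.pow_const 2).pow_const
        _).ennreal_ofReal).aemeasurable
    have hCS := cfm_lintegral_sq_le (volume.restrict (cell L)) hmeas
    rw [Measure.restrict_apply_univ, volume_cell, ← ENNReal.ofReal_pow hL.le] at hCS
    have e : ((∫⁻ y in cell L, ENNReal.ofReal ((fibrePsi Φ (Function.update X 0 y) ^ 2) ^
        (-(3 / 2 : ℝ)))) ^ (2 / 3 : ℝ)) ^ 3 = (∫⁻ y in cell L,
          ENNReal.ofReal ((fibrePsi Φ (Function.update X 0 y) ^ 2) ^ (-(3 / 2 : ℝ)))) ^ 2 := by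
      rw [← ENNReal.rpow_natCast, ← ENNReal.rpow_mul, ← ENNReal.rpow_natCast]
      norm_num
    have hpt : ∀ y, ENNReal.ofReal ((fibrePsi Φ (Function.update X 0 y) ^ 2) ^ (-(3 / 2 : ℝ))) ^ 2 *
        ENNReal.ofReal (fibreW Φ X) ≤ ENNReal.ofReal (L ^ 9) * G (Function.update X 0 y) := by
      intro y
      have hs : 0 < fibrePsi Φ (Function.update X 0 y) ^ 2 := pow_pos (fibrePsi_pos hL Φ hΦ _) 2
      simp only [hG, fibreW_update]
      rw [← ENNReal.ofReal_pow (Real.rpow_nonneg hs.le _), cfm_rpow_sq_eq hL hs,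
        ← ENNReal.ofReal_mul (by positivity), ← ENNReal.ofReal_mul hL9]
      refine ENNReal.ofReal_le_ofReal ?_
      have hW := fibreW_nonneg Φ X
      have h0 : 0 ≤ L ^ 9 * fibreW Φ X * (L ^ 3 * fibrePsi Φ (Function.update X 0 y) ^ 2) ^ 3 := by
        positivity
      nlinarith [h0]
    calc ((∫⁻ y in cell L, ENNReal.ofReal ((fibrePsi Φ (Function.update X 0 y) ^ 2) ^
          (-(3 / 2 : ℝ)))) ^ (2 / 3 : ℝ)) ^ 3 * ENNReal.ofReal (fibreW Φ X)
        = (∫⁻ y in cell L, ENNReal.ofReal ((fibrePsi Φ (Function.update X 0 y) ^ 2) ^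
            (-(3 / 2 : ℝ)))) ^ 2 * ENNReal.ofReal (fibreW Φ X) := by rw [e]
      _ ≤ (ENNReal.ofReal (L ^ 3) * ∫⁻ y in cell L, ENNReal.ofReal
            ((fibrePsi Φ (Function.update X 0 y) ^ 2) ^ (-(3 / 2 : ℝ))) ^ 2) *
              ENNReal.ofReal (fibreW Φ X) := by gcongr
      _ = ENNReal.ofReal (L ^ 3) * ∫⁻ y in cell L, ENNReal.ofReal
            ((fibrePsi Φ (Function.update X 0 y) ^ 2) ^ (-(3 / 2 : ℝ))) ^ 2 *
              ENNReal.ofReal (fibreW Φ X) := by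
          rw [mul_assoc, lintegral_mul_const' _ _ ENNReal.ofReal_ne_top]
      _ ≤ ENNReal.ofReal (L ^ 3) * ∫⁻ y in cell L, ENNReal.ofReal (L ^ 9) * G (Function.update X 0 y) :=
          mul_le_mul' le_rfl (lintegral_mono fun y => hpt y)
      _ = ENNReal.ofReal (L ^ 3) * (ENNReal.ofReal (L ^ 9) * ∫⁻ y in cell L, G (Function.update X 0 y)) := by
          rw [lintegral_const_mul' _ _ ENNReal.ofReal_ne_top]
  -- integrate over the bath
  have hC1 : C ≤ (C + 1) ^ 3 := by nlinarith [sq_nonneg C]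
  calc ∫⁻ X in cellN (m + 1) L, ((∫⁻ y in cell L, ENNReal.ofReal
          ((fibrePsi Φ (Function.update X 0 y) ^ 2) ^ (-(3 / 2 : ℝ)))) ^ (2 / 3 : ℝ)) ^ 3 *
            ENNReal.ofReal (fibreW Φ X)
      ≤ ∫⁻ X in cellN (m + 1) L, ENNReal.ofReal (L ^ 3) *
          (ENNReal.ofReal (L ^ 9) * ∫⁻ y in cell L, G (Function.update X 0 y)) :=
        lintegral_mono fun X => hfib X
    _ = ENNReal.ofReal (L ^ 3) * (ENNReal.ofReal (L ^ 9) *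
          (ENNReal.ofReal L ^ 3 * ∫⁻ X in cellN (m + 1) L, G X)) := by
        rw [lintegral_const_mul' _ _ ENNReal.ofReal_ne_top,
          lintegral_const_mul' _ _ ENNReal.ofReal_ne_top, lintegral_cellN_lintegral_update 0 hGm]
    _ ≤ ENNReal.ofReal (L ^ 3) * (ENNReal.ofReal (L ^ 9) *
          (ENNReal.ofReal L ^ 3 * ENNReal.ofReal (C * L ^ 3))) := by
        gcongr
    _ = ENNReal.ofReal (L ^ 3 * (L ^ 9 * (L ^ 3 * (C * L ^ 3)))) := by
        rw [← ENNReal.ofReal_pow hL.le, ← ENNReal.ofReal_mul hL3, ← ENNReal.ofReal_mul hL9,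
          ← ENNReal.ofReal_mul hL3]
    _ ≤ ENNReal.ofReal ((C + 1) * L ^ 6) ^ 3 := by
        rw [← ENNReal.ofReal_pow (by positivity)]
        refine ENNReal.ofReal_le_ofReal ?_
        calc L ^ 3 * (L ^ 9 * (L ^ 3 * (C * L ^ 3))) = C * L ^ 18 := by ring
          _ ≤ (C + 1) ^ 3 * L ^ 18 := by gcongr
          _ = ((C + 1) * L ^ 6) ^ 3 := by ring

/-! ### The Hölder split -/

/-- **The bath-Hölder split of the cell-scale Sobolev moment of the coarse beat charge.** Given gen 1's
`ConditionalDensityMoments` and a `(3/2)`-bath-moment bound for the flat mass of the coarse beat charge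
`ρ₁ = coarseOf L (waveBlocks n) Φ (cruxCharge n Φ)` in the crux's window,
`∫_{cellN} (L³ ∫_cell ‖ρ₁‖² dy)^{3/2} W ≤ K L³/‖n‖³`, the cell-scale Sobolev moment is windowed too:
`L⁻³ ∫_{cellN} (∫_cell ‖ρ₁‖² dy)(∫_cell (ψ²)^{-3/2} dy)^{2/3} W ≤ B L²/‖n‖²` with `B = (K+1)²(C₃+1)`
(Hölder `(3/2, 3)` in the bath: `cfm_assembly`, `cfm_hole_moment_le`). [folklore] -/
theorem coarseCellMoment_of_flatMassMoment (hcdm : ConditionalDensityMoments)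
    (hfm : LowDensityWindow fun m L n Φ K =>
      ∫⁻ X in cellN (m + 1) L,
          (ENNReal.ofReal (L ^ 3) * ∫⁻ y in cell L,
              ‖coarseOf L (waveBlocks n) Φ (cruxCharge n Φ) (Function.update X 0 y)‖ₑ ^ 2) ^ (3 / 2 : ℝ) *
            ENNReal.ofReal (fibreW Φ X) ≤
        ENNReal.ofReal (K * L ^ 3 / ‖(fun j => (n j : ℝ))‖ ^ 3)) :
    LowDensityWindow fun m L n Φ B =>
      (ENNReal.ofReal L ^ 3)⁻¹ *
          ∫⁻ X in cellN (m + 1) L,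
            (∫⁻ y in cell L, ‖coarseOf L (waveBlocks n) Φ (cruxCharge n Φ) (Function.update X 0 y)‖ₑ ^ 2) *
              (∫⁻ y in cell L,
                  ENNReal.ofReal ((fibrePsi Φ (Function.update X 0 y) ^ 2) ^ (-(3 / 2 : ℝ)))) ^ (2 / 3 : ℝ) *
              ENNReal.ofReal (fibreW Φ X) ≤
        ENNReal.ofReal (B * L ^ 2 / ‖(fun j => (n j : ℝ))‖ ^ 2) := by
  intro v hv hbdd M hM
  obtain ⟨ρ₁, K, hρ₁, hK, N₁, h₁⟩ := hfm v hv hbdd M hM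
  obtain ⟨ρ₂, C, hρ₂, hC, N₂, h₂⟩ := hcdm v hv hbdd 3
  refine ⟨min ρ₁ ρ₂, (K + 1) ^ 2 * (C + 1), lt_min hρ₁ hρ₂, by positivity, max N₁ N₂, ?_⟩
  intro m hm L hL hρ n hn hw Φ hE hΦ
  have hL3 : (0 : ℝ) ≤ L ^ 3 := by positivity
  have hρ₁' : ((m + 1 : ℕ) : ℝ) ≤ ρ₁ * L ^ 3 :=
    hρ.trans (mul_le_mul_of_nonneg_right (min_le_left _ _) hL3)
  have hρ₂' : ((m + 1 : ℕ) : ℝ) ≤ ρ₂ * L ^ 3 :=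
    hρ.trans (mul_le_mul_of_nonneg_right (min_le_right _ _) hL3)
  have hA := h₁ m (le_of_max_le_left hm) L hL hρ₁' n hn hw Φ hE hΦ
  have hCDM := h₂ m (le_of_max_le_right hm) L hL hρ₂' Φ hE hΦ
  -- the crux's norm of the window mode is positive
  set nn : ℝ := ‖(fun j => (n j : ℝ))‖
  have hnn0 : 0 < nn := by
    obtain ⟨j, hj⟩ := Function.ne_iff.mp hn
    refine norm_pos_iff.mpr (Function.ne_iff.mpr ⟨j, ?_⟩)
    simpa using hj
  -- measurability of the three bath functions
  have hu : Continuous fun p : Config (m + 1) × Space => Function.update p.1 0 p.2 :=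
    continuous_fst.update 0 continuous_snd
  have hqm : Measurable (coarseOf L (waveBlocks n) Φ (cruxCharge n Φ)) :=
    cfm_measurable_coarseOf hL _ Φ hΦ (continuous_cruxCharge hL n Φ hΦ)
  have hUm : Measurable fun X : Config (m + 1) => ∫⁻ y in cell L,
      ‖coarseOf L (waveBlocks n) Φ (cruxCharge n Φ) (Function.update X 0 y)‖ₑ ^ 2 := by
    have h : Measurable fun p : Config (m + 1) × Space =>
        ‖coarseOf L (waveBlocks n) Φ (cruxCharge n Φ) (Function.update p.1 0 p.2)‖ₑ ^ 2 :=
      ((hqm.comp hu.measurable).enorm.pow_const 2)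
    exact h.lintegral_prod_right' (ν := volume.restrict (cell L))
  have hPm : Measurable fun X : Config (m + 1) => (∫⁻ y in cell L,
      ENNReal.ofReal ((fibrePsi Φ (Function.update X 0 y) ^ 2) ^ (-(3 / 2 : ℝ)))) ^ (2 / 3 : ℝ) := by
    have h : Measurable fun p : Config (m + 1) × Space =>
        ENNReal.ofReal ((fibrePsi Φ (Function.update p.1 0 p.2) ^ 2) ^ (-(3 / 2 : ℝ))) :=
      ((((continuous_fibrePsi hL Φ hΦ).comp hu).measurable.pow_const 2).pow_const _).ennreal_ofReal
    exact (h.lintegral_prod_right' (ν := volume.restrict (cell L))).pow_const _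
  have hWm : Measurable fun X : Config (m + 1) => ENNReal.ofReal (fibreW Φ X) :=
    (measurable_fibreW Φ).ennreal_ofReal
  -- the two windowed inputs, in the currency `a³`, `b³`
  have h30 : ENNReal.ofReal (L ^ 3) ≠ 0 := (ENNReal.ofReal_pos.2 (by positivity)).ne'
  have hx1 : ENNReal.ofReal (K * L ^ 3 / nn ^ 3) ≤ ENNReal.ofReal ((K + 1) * L / nn) ^ 3 := by
    rw [← ENNReal.ofReal_pow (by positivity)]
    refine ENNReal.ofReal_le_ofReal ?_
    have hK1 : K ≤ (K + 1) ^ 3 := by nlinarith [sq_nonneg K]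
    rw [div_pow, mul_pow]
    gcongr
  have hPart := cfm_hole_moment_le hL Φ hΦ hC.le hCDM
  have key := cfm_assembly (volume.restrict (cellN (m + 1) L))
    (U := fun X : Config (m + 1) => ∫⁻ y in cell L,
      ‖coarseOf L (waveBlocks n) Φ (cruxCharge n Φ) (Function.update X 0 y)‖ₑ ^ 2)
    (P := fun X : Config (m + 1) => (∫⁻ y in cell L,
      ENNReal.ofReal ((fibrePsi Φ (Function.update X 0 y) ^ 2) ^ (-(3 / 2 : ℝ)))) ^ (2 / 3 : ℝ))
    (W := fun X : Config (m + 1) => ENNReal.ofReal (fibreW Φ X))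
    hUm.aemeasurable hPm.aemeasurable hWm.aemeasurable h30 ENNReal.ofReal_ne_top
    (hA.trans hx1) hPart
  rw [← ENNReal.ofReal_pow hL.le]
  refine key.trans ?_
  -- `L⁻³ · L⁻³ · ((K+1)L/‖n‖)² · (C+1)L⁶ = (K+1)²(C+1) L²/‖n‖²`
  have hL3p : (0 : ℝ) < L ^ 3 := by positivity
  rw [← ENNReal.ofReal_inv_of_pos hL3p, ← ENNReal.ofReal_pow (by positivity),
    ← ENNReal.ofReal_mul (by positivity), ← ENNReal.ofReal_mul (by positivity),
    ← ENNReal.ofReal_mul (by positivity)]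
  refine ENNReal.ofReal_le_ofReal (le_of_eq ?_)
  field_simp

end Summit.AtomisticToContinuum.BoseEinsteinCondensation.Cruxes.FibreConductance.ConditionalLawPoincare

end
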